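import Mathlib.RingTheory.Ideal.Quotient.Operations
import Mathlib.RingTheory.Localization.AsSubring
import Literature.AlgebraicGeometry.Resolution.RankOneReductionProofs
import HarnessLib

/-!
# Rank-one reduction, absolute form: the residue ring of a model (helper for `RankOneReduction`)

Support file for item `stmt-ResolutionOfSingularities-0563`
(`Theses.Valuative.RankOneReduction`, the ABSOLUTE rank-one reduction of local uniformization).

For a composite valuation `ν = ν₁ ∘ ν₂` of `K/k` (`O ≤ O₁` valuation rings of `K`, `ν₂` the
valuation of `κ(O₁)` with ring `residueValuationSubring O O₁ _`) and an affine model `A ⊆ O`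
with centres `P ⊆ Q` of `ν₁`, `ν` on `A`, the local ring `A_Q / P A_Q` is the local ring of
the residue ring `Φ(A) ⊆ κ(O₁)` at the centre of `ν₂` (Novacoski–Spivakovsky 2014, Lemma 2.15,
first part). Here this is recorded in the form the absolute reduction consumes: if `Φ(A)` is
(the image `ι(B)` of) a finitely generated `k`-subalgebra `B` of a subfield `κ → κ(O₁)` whose
localisation at the centre of `ν₂|κ` is regular, then `A_Q / P A_Q` is regular
(`isRegularLocalRing_quotCentre_of_residues_eq`). The argument is the one of
`Literature.AlgebraicGeometry.Resolution.novacoskiSpivakovsky2014_cor217` (Claim 2 there),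
isolated from the lifting of generators.

Source: J. Novacoski, M. Spivakovsky, *Reduction of local uniformization to the rank one case*,
arXiv:1204.4751, Lemma 2.15.
-/

set_option linter.dupNamespace false  -- Summit.<S>.<S>.Theorems is the D-0017 layout (single-conjunct summit)

noncomputable section

open IsLocalRing
open Literature.AlgebraicGeometry.Resolution

namespace Summit.ResolutionOfSingularities.ResolutionOfSingularities.Theorems

universe u v

variable {k : Type u} {K : Type v} [CommRing k] [Field K] [Algebra k K]

/-- Membership in the centre of a valuation ring `O'` on a model `A ⊆ O'`: `a ∈ m_{O'} ∩ A` iff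
`ν'(a) < 1`. [folklore] -/
theorem mem_comap_maximalIdeal_iff_valuation_lt_one (O' : ValuationSubring K) (A : Subalgebra k K)
    (h : A.toSubring ≤ O'.toSubring) (a : A.toSubring) :
    a ∈ ((maximalIdeal O').comap (Subring.inclusion h)) ↔ O'.valuation a < 1 := by
  rw [Ideal.mem_comap, ValuationSubring.valuation_lt_one_iff]
  rfl

/-- **The local ring `A_Q / P A_Q` of a model is the local ring of its residue ring at the centre
of `ν₂`** (Novacoski–Spivakovsky 2014, Lemma 2.15, first part), in transported form: for
`ν = ν₁ ∘ ν₂` on `K/k` (`O ≤ O₁`), an affine model `A ⊆ O` with centres `P ⊆ Q` of `ν₁`, `ν`,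
a field `κ` with an embedding `ι : κ → κ(O₁)` and a `k`-subalgebra `B ⊆ κ` lying in the
valuation ring of `ν₂|κ` with `Frac B = κ`, such that the residues of `A` in `κ(O₁)` are
exactly `ι(B)`: if `B` localised at the centre of `ν₂|κ` is regular, then so is `A_Q / P A_Q`.
(The residue map `A_Q → κ(O₁)`, `a/s ↦ ā/s̄`, has kernel `P A_Q` and range `ι(B_{centre})`.)
[cite: NovacoskiSpivakovsky2014, Lemma 2.15] -/
theorem isRegularLocalRing_quotCentre_of_residues_eq (O O₁ : ValuationSubring K) (hO : O ≤ O₁)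
    (A : Subalgebra k K) (hA : A.toSubring ≤ O.toSubring)
    {κ : Type*} [Field κ] [Algebra k κ] (ι : κ →+* ResidueField O₁)
    (B : Subalgebra k κ)
    (hB : B.toSubring ≤ ((residueValuationSubring O O₁ hO).comap ι).toSubring)
    [IsFractionRing B.toSubring κ]
    (hregB : IsRegularLocalRing (Localization.AtPrime
      ((maximalIdeal ((residueValuationSubring O O₁ hO).comap ι)).comap (Subring.inclusion hB))))
    (hAB : ∀ x : A.toSubring, ∃ b ∈ B, residue O₁ ⟨(x : K), hO (hA x.2)⟩ = ι b)
    (hBA : ∀ b ∈ B, ∃ x : A.toSubring, residue O₁ ⟨(x : K), hO (hA x.2)⟩ = ι b) :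
    IsRegularLocalRing
      (Localization.AtPrime ((maximalIdeal O).comap (Subring.inclusion hA)) ⧸
        ((maximalIdeal O₁).comap (Subring.inclusion (hA.trans hO))).map
          (algebraMap A.toSubring
            (Localization.AtPrime ((maximalIdeal O).comap (Subring.inclusion hA))))) := by
  classical
  have hAO₁ : A.toSubring ≤ O₁.toSubring := hA.trans hO
  set O₂ := residueValuationSubring O O₁ hO with hO₂def
  set O₂' := O₂.comap ι with hO₂'def
  set Q := ((maximalIdeal O).comap (Subring.inclusion hA)) with hQdef
  set P := ((maximalIdeal O₁).comap (Subring.inclusion hAO₁)) with hPdef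
  have hPQ : P ≤ Q := centre_mono O O₁ hO A hA
  let S := Localization.AtPrime Q
  let ψ : A.toSubring →+* ResidueField O₁ := ((residue O₁).comp (Subring.inclusion hAO₁))
  have hψ : ∀ x : A.toSubring, ψ x = residue O₁ ⟨(x : K), hO (hA x.2)⟩ := fun x => rfl
  -- units: `s ∉ Q` iff `ψ s` is a unit of `O₂`
  have hψO₂ : ∀ x : A.toSubring, ψ x ∈ O₂ := fun x =>
    (residue_mem_residueValuationSubring_iff O O₁ hO _).mpr (hA x.2)
  have hQiff : ∀ s : A.toSubring, s ∉ Q ↔ IsUnit (⟨ψ s, hψO₂ s⟩ : O₂) := by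
    intro s
    rw [mem_comap_maximalIdeal_iff_valuation_lt_one,
      valuation_lt_one_iff_residue O O₁ hO (s : K) (hA s.2)]
    exact not_valuation_lt_one_iff O₂ ⟨ψ s, hψO₂ s⟩
  have hunits : ∀ s : Q.primeCompl, IsUnit (ψ s) := fun s =>
    isUnit_residue_inclusion O₁ A hAO₁ s (fun h => s.2 (hPQ h))
  let θ : S →+* ResidueField O₁ := IsLocalization.lift hunits
  have hθmk : ∀ (a : A.toSubring) (s : Q.primeCompl),
      θ (IsLocalization.mk' S a s) = ψ a / ψ s := by
    intro a s
    rw [IsLocalization.lift_mk'_spec]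
    field_simp [(hunits s).ne_zero]
  -- the kernel of `θ` is `P A_Q`
  have hker : RingHom.ker θ = P.map (algebraMap A.toSubring S) := by
    apply le_antisymm
    · intro x hx
      rw [← IsLocalization.mk'_sec (M := Q.primeCompl) S x] at hx ⊢
      set a := (IsLocalization.sec Q.primeCompl x).1
      set s := (IsLocalization.sec Q.primeCompl x).2
      rw [RingHom.mem_ker, hθmk, div_eq_zero_iff, or_iff_left (hunits s).ne_zero] at hx
      have ha : a ∈ P := (residue_inclusion_eq_zero_iff O₁ A hAO₁ a).mp hx
      rw [IsLocalization.mk'_eq_mul_mk'_one]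
      exact Ideal.mul_mem_right _ _ (Ideal.mem_map_of_mem _ ha)
    · rw [Ideal.map_le_iff_le_comap]
      intro a ha
      rw [Ideal.mem_comap, RingHom.mem_ker, IsLocalization.lift_eq]
      exact (residue_inclusion_eq_zero_iff O₁ A hAO₁ a).mpr ha
  -- the range of `θ` is `ι` of the local ring of `B` at the centre of `ν₂`
  have hBO₂' : ∀ b : κ, b ∈ B → b ∈ O₂' := fun b hb => hB hb
  have hunitB : ∀ (b : κ) (hb : b ∈ B), O₂'.valuation b = 1 ↔
      IsUnit (⟨ι b, hBO₂' b hb⟩ : O₂) := by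
    intro b hb
    rw [← isUnit_comap_iff O₂ ι b (hBO₂' b hb), ValuationSubring.valuation_eq_one_iff]
  have hrangeθ : θ.range = ((Localization.subalgebra.ofField κ
      ((maximalIdeal O₂').comap (Subring.inclusion hB)).primeCompl
      (Ideal.primeCompl_le_nonZeroDivisors _))).toSubring.map ι := by
    ext y
    constructor
    · rintro ⟨x, rfl⟩
      rw [← IsLocalization.mk'_sec (M := Q.primeCompl) S x]
      set a := (IsLocalization.sec Q.primeCompl x).1
      set s := (IsLocalization.sec Q.primeCompl x).2
      obtain ⟨ba, hba, hψa⟩ := hAB a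
      obtain ⟨bs, hbs, hψs⟩ := hAB s
      rw [← hψ] at hψa hψs
      rw [hθmk, Subring.mem_map]
      refine ⟨ba * bs⁻¹, ?_, ?_⟩
      · change ba * bs⁻¹ ∈ (Localization.subalgebra.ofField κ
          ((maximalIdeal O₂').comap (Subring.inclusion hB)).primeCompl
          (Ideal.primeCompl_le_nonZeroDivisors _))
        rw [mem_centreLocalization_iff]
        refine ⟨ba, hba, bs, hbs, ?_, rfl⟩
        rw [hunitB bs hbs]
        have e : (⟨ι bs, hBO₂' bs hbs⟩ : O₂) = ⟨ψ s, hψO₂ s⟩ := Subtype.ext hψs.symm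
        rw [e]
        exact (hQiff s).mp s.2
      · rw [map_mul, map_inv₀, ← hψa, ← hψs, div_eq_mul_inv]
    · intro hy
      rw [Subring.mem_map] at hy
      obtain ⟨x, hx, rfl⟩ := hy
      change x ∈ (Localization.subalgebra.ofField κ
          ((maximalIdeal O₂').comap (Subring.inclusion hB)).primeCompl
          (Ideal.primeCompl_le_nonZeroDivisors _)) at hx
      rw [mem_centreLocalization_iff] at hx
      obtain ⟨b₁, hb₁, w, hw, hw1, rfl⟩ := hx
      obtain ⟨a₁, ha₁⟩ := hBA b₁ hb₁
      obtain ⟨s₁, hs₁⟩ := hBA w hw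
      rw [← hψ] at ha₁ hs₁
      have hs₁Q : s₁ ∉ Q := by
        rw [hQiff s₁]
        have e : (⟨ψ s₁, hψO₂ s₁⟩ : O₂) = ⟨ι w, hBO₂' w hw⟩ := Subtype.ext hs₁
        rw [e]
        exact (hunitB w hw).mp hw1
      refine ⟨IsLocalization.mk' S a₁ (⟨s₁, hs₁Q⟩ : Q.primeCompl), ?_⟩
      rw [hθmk]
      change ψ a₁ / ψ s₁ = ι (b₁ * w⁻¹)
      rw [map_mul, map_inv₀, ha₁, hs₁, div_eq_mul_inv]
  -- assemble the isomorphism `S / P S ≅ B_{m_{ν₂} ∩ B}` and transfer regularity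
  set X : Subalgebra B.toSubring κ := Localization.subalgebra.ofField κ
      ((maximalIdeal O₂').comap (Subring.inclusion hB)).primeCompl
      (Ideal.primeCompl_le_nonZeroDivisors _) with hXdef
  have hregL : IsRegularLocalRing X :=
    (isRegularLocalRing_iff_centreLocalization O₂' B hB).mp hregB
  let e₁ : S ⧸ P.map (algebraMap A.toSubring S) ≃+* θ.range :=
    (Ideal.quotEquivOfEq hker.symm).trans (RingHom.quotientKerEquivRange θ)
  let e₂ : θ.range ≃+* X.toSubring.map ι := RingEquiv.subringCongr hrangeθ
  let e₃ : X.toSubring ≃+* X.toSubring.map ι :=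
    Subring.equivMapOfInjective X.toSubring ι ι.injective
  haveI := hregL
  exact IsRegularLocalRing.of_ringEquiv (R := X) (e₃.trans (e₂.symm.trans e₁.symm))

end Summit.ResolutionOfSingularities.ResolutionOfSingularities.Theorems

end
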